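import Mathlib.Algebra.Polynomial.Roots
import Mathlib.Algebra.Polynomial.Degree.Defs
import Mathlib.Algebra.Field.ZMod
import Mathlib.Algebra.BigOperators.Ring.Finset
import Mathlib.Data.Real.Basic
import Mathlib.Tactic.Positivity
import Mathlib.Tactic.FieldSimp
import HarnessLib

/-!
# Reed–Solomon transversals (Kumar–Saraf 2017, Lemma 8.1)

Topic `Literature/Computability/AlgebraicComplexity`; infrastructure for the printed proof of
`kumarSaraf2017_imm_homDepthFour` (`HomogeneousDepthFour.lean`), Step 4 of the roadmap. The set
`𝒯` of transversals along which `IMM^*` is differentiated is a Reed–Solomon code: for a prime `q`,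
`r ≤ q` blocks and a dimension `Dg ≤ r`, the codeword of a coefficient vector `u : Fin Dg → 𝔽_q`
is `b ↦ ∑_i u_i b^i` (`b < r`, read in `𝔽_q`), [KS, Lemma 8.1] ("polynomials of degree at most
`r - 1` evaluated at `r'` distinct field elements … distance at least `r' - r`").

* `rsCode u b = ∑_i u_i b^i`; `rsPoly u = ∑_i C u_i X^i`, `eval_rsPoly`, `natDegree_rsPoly_lt`.
* **`rsCode_eq_of_agreeOn`** — two codewords agreeing on `≥ Dg` blocks are equal (a nonzero
  polynomial of degree `< Dg` has `< Dg` roots), hence `rsCode_injective` (`|𝒯| = q^{Dg}`).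
* **`card_agreeOn_le`** — the codewords agreeing with a fixed one on a set `U` of blocks number
  at most `q^{Dg - |U|}`.
* **`sum_prod_agree_le`** — for `0 ≤ y ≤ x`,
  `∑_{u₂} ∏_b (x if the codewords of u₁, u₂ agree in block b, else y) ≤ q^{Dg} (y + (x-y)/q)^r + x^r`
  (the sum over the second transversal in `E[T₃]`).

Everything is proved; no named facts.

## References

* M. Kumar, S. Saraf, *On the power of homogeneous depth 4 arithmetic circuits*, SIAM J. Comput.
  46 (2017) 336–387 (arXiv:1404.1950): Lemma 8.1, §8.4.
-/

noncomputable section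

namespace Literature.Computability.AlgebraicComplexity.KumarSaraf

open Finset Polynomial

variable {q : ℕ} {r Dg : ℕ}

/-- **The Reed–Solomon codeword** of the coefficient vector `u`: block `b ↦ ∑_i u_i b^i ∈ 𝔽_q`.
[cite: KumarSaraf2017, Lemma 8.1] -/
def rsCode (u : Fin Dg → ZMod q) (b : Fin r) : ZMod q :=
  ∑ i : Fin Dg, u i * ((b : ℕ) : ZMod q) ^ (i : ℕ)

/-- The polynomial of a coefficient vector. [cite: KumarSaraf2017, Lemma 8.1] -/
def rsPoly (u : Fin Dg → ZMod q) : (ZMod q)[X] :=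
  ∑ i : Fin Dg, C (u i) * X ^ (i : ℕ)

/-- Codewords are evaluations of the polynomial. [folklore] -/
theorem eval_rsPoly (u : Fin Dg → ZMod q) (b : Fin r) :
    eval (((b : ℕ) : ZMod q)) (rsPoly u) = rsCode u b := by
  rw [rsPoly, eval_finsetSum, rsCode]
  simp only [eval_mul, eval_C, eval_pow, eval_X]

/-- The polynomial has degree `< Dg`. [folklore] -/
theorem natDegree_rsPoly_lt (u : Fin Dg → ZMod q) (hDg : 0 < Dg) : (rsPoly u).natDegree < Dg := by
  have h := degree_sum_fin_lt u
  rw [rsPoly]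
  by_cases h0 : (∑ i : Fin Dg, C (u i) * X ^ (i : ℕ)) = 0
  · rw [h0, natDegree_zero]; exact hDg
  · exact (natDegree_lt_iff_degree_lt h0).2 h

/-- The polynomial is additive in the coefficients. [folklore] -/
theorem rsPoly_sub (u v : Fin Dg → ZMod q) : rsPoly u - rsPoly v = rsPoly (u - v) := by
  simp only [rsPoly, ← sum_sub_distrib, Pi.sub_apply, C_sub, sub_mul]

/-- The coefficients of the polynomial. [folklore] -/
theorem coeff_rsPoly (u : Fin Dg → ZMod q) (i : Fin Dg) : (rsPoly u).coeff i = u i := by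
  rw [rsPoly, finsetSum_coeff]
  simp only [coeff_C_mul, coeff_X_pow]
  rw [sum_eq_single i]
  · simp
  · intro j _ hji
    rw [if_neg (fun h => hji (Fin.ext h).symm)]
    simp
  · intro h; exact absurd (mem_univ i) h

/-- The block labels are distinct field elements (`r ≤ q`). [folklore] -/
theorem natCast_block_injective (hrq : r ≤ q) :
    Function.Injective fun b : Fin r => ((b : ℕ) : ZMod q) := by
  intro b b' h
  have hv := congrArg ZMod.val h
  simp only [ZMod.val_natCast] at hv
  rw [Nat.mod_eq_of_lt (lt_of_lt_of_le b.2 hrq), Nat.mod_eq_of_lt (lt_of_lt_of_le b'.2 hrq)] at hv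
  exact Fin.ext hv

/-- **Distance of the Reed–Solomon code** ([KS, Lemma 8.1]): two codewords agreeing on at least
`Dg` blocks are equal (as coefficient vectors). [cite: KumarSaraf2017, Lemma 8.1] -/
theorem rsCode_eq_of_agreeOn [Fact q.Prime] (hrq : r ≤ q) (hDg : 0 < Dg) {u v : Fin Dg → ZMod q} {U : Finset (Fin r)}
    (hU : Dg ≤ U.card) (hagree : ∀ b ∈ U, rsCode u b = rsCode v b) : u = v := by
  classical
  -- the difference polynomial vanishes on the images of `U`
  set p := rsPoly (u - v) with hp
  have hzero : p = 0 := by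
    refine eq_zero_of_natDegree_lt_card_of_eval_eq_zero' p (U.image fun b : Fin r => ((b : ℕ) : ZMod q))
      ?_ ?_
    · intro z hz
      obtain ⟨b, hb, rfl⟩ := mem_image.1 hz
      rw [hp, ← rsPoly_sub, eval_sub, eval_rsPoly, eval_rsPoly, hagree b hb, sub_self]
    · rw [card_image_of_injective _ (natCast_block_injective hrq)]
      exact lt_of_lt_of_le (natDegree_rsPoly_lt _ hDg) hU
  funext i
  have h := coeff_rsPoly (u - v) i
  rw [← hp, hzero, coeff_zero, Pi.sub_apply] at h
  exact (sub_eq_zero.1 h.symm)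

/-- **`|𝒯| = q^{Dg}`**: the coefficient vector is determined by the codeword (`Dg ≤ r ≤ q`).
[cite: KumarSaraf2017, Lemma 8.1] -/
theorem rsCode_injective [Fact q.Prime] (hrq : r ≤ q) (hDg : 0 < Dg) (hDr : Dg ≤ r) :
    Function.Injective (rsCode (q := q) (r := r) (Dg := Dg)) := by
  intro u v h
  refine rsCode_eq_of_agreeOn hrq hDg (U := univ) (by rwa [card_univ, Fintype.card_fin]) ?_
  intro b _; rw [h]

/-- **Codewords agreeing with a fixed one on `U` number at most `q^{Dg - |U|}`** (extend `U` to
`Dg` blocks, or shrink it; the values on the extra blocks determine the codeword).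
[cite: KumarSaraf2017, Lemma 8.1] -/
theorem card_agreeOn_le [Fact q.Prime] (hrq : r ≤ q) (hDg : 0 < Dg) (hDr : Dg ≤ r) (u₁ : Fin Dg → ZMod q)
    (U : Finset (Fin r)) :
    ((univ : Finset (Fin Dg → ZMod q)).filter fun u₂ => ∀ b ∈ U, rsCode u₂ b = rsCode u₁ b).card
      ≤ q ^ (Dg - U.card) := by
  classical
  by_cases hUD : Dg ≤ U.card
  · -- at most one codeword
    rw [Nat.sub_eq_zero_of_le hUD, pow_zero, card_le_one]
    intro u hu v hv
    rw [mem_filter] at hu hv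
    exact rsCode_eq_of_agreeOn hrq hDg hUD fun b hb => (hu.2 b hb).trans (hv.2 b hb).symm
  · push Not at hUD
    -- extend `U` to `U'` with `|U'| = Dg`
    obtain ⟨U', hUU', -, hcard⟩ := exists_subsuperset_card_eq (subset_univ U) hUD.le
      (by rw [card_univ, Fintype.card_fin]; exact hDr)
    -- `u₂ ↦ (its codeword on U' \\ U)` is injective on the fibre
    have hinj : Set.InjOn (fun u₂ : Fin Dg → ZMod q => fun b : ↥(U' \ U) => rsCode u₂ b.1)
        ↑((univ : Finset (Fin Dg → ZMod q)).filter fun u₂ => ∀ b ∈ U, rsCode u₂ b = rsCode u₁ b) := by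
      intro u hu v hv huv
      rw [mem_coe, mem_filter] at hu hv
      refine rsCode_eq_of_agreeOn hrq hDg hcard.ge fun b hb => ?_
      by_cases hbU : b ∈ U
      · exact (hu.2 b hbU).trans (hv.2 b hbU).symm
      · have := congrFun huv ⟨b, mem_sdiff.2 ⟨hb, hbU⟩⟩
        exact this
    calc _ ≤ (univ : Finset (↥(U' \ U) → ZMod q)).card :=
          card_le_card_of_injOn _ (fun _ _ => mem_univ _) hinj
      _ = q ^ (Dg - U.card) := by
          rw [card_univ, Fintype.card_fun, ZMod.card, Fintype.card_coe, card_sdiff_of_subset hUU', hcard]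

/-- **The sum over the second transversal** (for `E[T₃]`): with `x ≥ y ≥ 0`,
`∑_{u₂} ∏_b (x if agree_b else y) ≤ q^{Dg} (y + (x - y)/q)^r + x^r`. [cite: KumarSaraf2017, Lemma 8.7] -/
theorem sum_prod_agree_le [Fact q.Prime] (hrq : r ≤ q) (hDg : 0 < Dg) (hDr : Dg ≤ r) (u₁ : Fin Dg → ZMod q)
    {x y : ℝ} (hy : 0 ≤ y) (hxy : y ≤ x) :
    ∑ u₂ : Fin Dg → ZMod q, ∏ b : Fin r, (if rsCode u₂ b = rsCode u₁ b then x else y) ≤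
      (q : ℝ) ^ Dg * (y + (x - y) / q) ^ r + x ^ r := by
  classical
  have hq : (0 : ℝ) < q := by exact_mod_cast (Fact.out : q.Prime).pos
  -- expand `∏_b (y + (x-y) 1[agree_b]) = ∑_{U ⊆ agree set} (x-y)^{|U|} y^{r-|U|}`
  have hexp : ∀ u₂ : Fin Dg → ZMod q,
      ∏ b : Fin r, (if rsCode u₂ b = rsCode u₁ b then x else y) =
        ∑ U ∈ (univ.filter fun b : Fin r => rsCode u₂ b = rsCode u₁ b).powerset,
          (x - y) ^ U.card * y ^ (r - U.card) := by
    intro u₂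
    set Ag := univ.filter fun b : Fin r => rsCode u₂ b = rsCode u₁ b with hAg
    have h1 : ∏ b : Fin r, (if rsCode u₂ b = rsCode u₁ b then x else y) =
        (∏ b ∈ Ag, ((x - y) + y)) * ∏ b ∈ univ \ Ag, y := by
      rw [← prod_sdiff (subset_univ Ag), mul_comm]
      congr 1
      · exact prod_congr rfl fun b hb => by rw [if_pos (mem_filter.1 hb).2]; ring
      · exact prod_congr rfl fun b hb => by
          rw [if_neg]; exact fun h => (mem_sdiff.1 hb).2 (mem_filter.2 ⟨mem_univ _, h⟩)
    rw [h1, prod_add, sum_mul]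
    refine sum_congr rfl fun U hU => ?_
    rw [mem_powerset] at hU
    rw [prod_const, prod_const, prod_const, card_sdiff_of_subset hU, card_univ_sdiff, Fintype.card_fin,
      mul_assoc, ← pow_add]
    congr 2
    have := card_le_card hU
    have h2 := card_le_univ Ag
    rw [Fintype.card_fin] at h2
    omega
  simp_rw [hexp]
  -- exchange the sums: `∑_{u₂} ∑_{U ⊆ Ag(u₂)} = ∑_U #{u₂ : U ⊆ Ag(u₂)} · …`
  have hswap : ∑ u₂ : Fin Dg → ZMod q,
      ∑ U ∈ (univ.filter fun b : Fin r => rsCode u₂ b = rsCode u₁ b).powerset,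
        (x - y) ^ U.card * y ^ (r - U.card) =
      ∑ U : Finset (Fin r), (((univ : Finset (Fin Dg → ZMod q)).filter fun u₂ =>
        ∀ b ∈ U, rsCode u₂ b = rsCode u₁ b).card : ℝ) * ((x - y) ^ U.card * y ^ (r - U.card)) := by
    have : ∀ u₂ : Fin Dg → ZMod q,
        ∑ U ∈ (univ.filter fun b : Fin r => rsCode u₂ b = rsCode u₁ b).powerset,
          (x - y) ^ U.card * y ^ (r - U.card) =
        ∑ U : Finset (Fin r), if ∀ b ∈ U, rsCode u₂ b = rsCode u₁ b then
          (x - y) ^ U.card * y ^ (r - U.card) else 0 := by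
      intro u₂
      rw [← sum_filter]
      congr 1
      ext U
      simp [subset_iff]
    simp_rw [this]
    rw [sum_comm]
    refine sum_congr rfl fun U _ => ?_
    rw [← sum_filter, sum_const, nsmul_eq_mul]
  rw [hswap]
  -- bound the counts and split `|U| ≤ Dg` / `|U| > Dg`
  have hxy0 : 0 ≤ x - y := by linarith
  have hterm : ∀ U : Finset (Fin r), (((univ : Finset (Fin Dg → ZMod q)).filter fun u₂ =>
      ∀ b ∈ U, rsCode u₂ b = rsCode u₁ b).card : ℝ) * ((x - y) ^ U.card * y ^ (r - U.card)) ≤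
      (q : ℝ) ^ Dg * (((x - y) / q) ^ U.card * y ^ (r - U.card)) + (x - y) ^ U.card * y ^ (r - U.card) := by
    intro U
    have hc := card_agreeOn_le hrq hDg hDr u₁ U
    have hnn : 0 ≤ (x - y) ^ U.card * y ^ (r - U.card) := by positivity
    by_cases hUD : U.card ≤ Dg
    · have hcast : (((univ : Finset (Fin Dg → ZMod q)).filter fun u₂ =>
          ∀ b ∈ U, rsCode u₂ b = rsCode u₁ b).card : ℝ) ≤ (q : ℝ) ^ (Dg - U.card) := by
        exact_mod_cast hc
      calc _ ≤ (q : ℝ) ^ (Dg - U.card) * ((x - y) ^ U.card * y ^ (r - U.card)) :=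
            mul_le_mul_of_nonneg_right hcast hnn
        _ = (q : ℝ) ^ Dg * (((x - y) / q) ^ U.card * y ^ (r - U.card)) := by
            rw [div_pow]
            have : (q : ℝ) ^ Dg = (q : ℝ) ^ (Dg - U.card) * (q : ℝ) ^ U.card := by
              rw [← pow_add, Nat.sub_add_cancel hUD]
            rw [this]
            field_simp
        _ ≤ _ := le_add_of_nonneg_right hnn
    · push Not at hUD
      have h1 : (((univ : Finset (Fin Dg → ZMod q)).filter fun u₂ =>
          ∀ b ∈ U, rsCode u₂ b = rsCode u₁ b).card : ℝ) ≤ 1 := by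
        rw [Nat.sub_eq_zero_of_le hUD.le, pow_zero] at hc
        exact_mod_cast hc
      calc _ ≤ 1 * ((x - y) ^ U.card * y ^ (r - U.card)) := mul_le_mul_of_nonneg_right h1 hnn
        _ = (x - y) ^ U.card * y ^ (r - U.card) := one_mul _
        _ ≤ _ := le_add_of_nonneg_left (by positivity)
  refine (sum_le_sum fun U _ => hterm U).trans (le_of_eq ?_)
  rw [sum_add_distrib, ← mul_sum]
  -- binomial theorem over subsets: `∑_U a^{|U|} b^{r-|U|} = (a + b)^r`
  have hbin : ∀ a b : ℝ, ∑ U : Finset (Fin r), a ^ U.card * b ^ (r - U.card) = (b + a) ^ r := by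
    intro a b
    have h := Finset.sum_pow_mul_eq_add_pow a b (univ : Finset (Fin r))
    rw [powerset_univ, card_univ, Fintype.card_fin] at h
    rw [h, add_comm]
  rw [hbin, hbin]
  congr 1
  ring

end Literature.Computability.AlgebraicComplexity.KumarSaraf

end
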